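import Summits.QuantumFields.BalabanUV.T4Continuum.Spine.NE2.ComposedRemainderTwoLevel
import Summits.QuantumFields.BalabanUV.T4Continuum.Spine.NE2.OneStepRemainderLoopLipschitz

/-!
# T⁴ programme, spine node NE2 (U1a) — R14 W3c, file 4: THE (3.26)-SHAPE END WITH THE FULL LINEARISED COMPOSED AVERAGING WHOSE REMAINDER COEFFICIENTS ARE THE §A FUNCTIONAL
# CALCULUS OF THE BACKGROUND's LOOP LOGARITHMS — the (126) size letters AND the cross-coefficient letters DISCHARGED from plaquette ∕ closeness letters of the data (cell `pub-balaban-gaps`, seat ne2 gen 6)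

`ComposedRemainderTwoLevel.composed_full_averaging_rate_of_letters` (gen 5, p365410 ✓) is the (3.26)-shape END with print's composed averaging ([B9] (3.15)) + [B7] (124)'s remainders at every
step, the remainder `E″` CONSTRUCTED, its three `AveragingLaws` fields PROVED, and the remainder hypotheses LETTERS ONLY — among them the (126) coefficient letters
`hG₁/hG₂/hG₃ : ‖G_i‖ ≤ γ k i` and `hRc : ‖R̄_{0,c}‖ ≤ 1` on an abstract `RemCoeff` datum `Cf k`.  THIS FILE instantiates `Cf k := remCoeffOf L M (U k) c e (W k)` (file 3: (124)'s
coefficient operators as `g(∓i ad)`, `g⁻¹`, `e^{±i ad}` of the loop logarithms `Y_x = (1/i) log U(Γ_{c,x} ∪ (−c))`, `Y = Σ_x L^{−d}Y_x` of the FUNDAMENTAL field tower `U k` of problem `k`, in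
the adjoint frame `(c, P, e)`; `R̄_{0,c}` = the adjoint field `W k i` at the coarse bond) and DISCHARGES those four hypotheses by `OneStepRemainderLoopCoeff.norm_remCoeffOf_G₁/₂/₃_le` and
`norm_remCoeffOf_Rc_le`: the letter becomes `γ k i = 64·d·L²·p k (i+1)` with `p k j` the commutator-form PLAQUETTE LETTER of the level-`j` fundamental field of problem `k` ((44)/(109)
`|V₀(∂p) − 1| < α₀`; print p. 36 «`O(L²α₀)`»), under `d·L²·p ≤ 1/16` and membership of the `Y_x` in the frame's carrier `P` (automatic for `P` = all hermitian matrices,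
`YxT_mem_of_hermitian`); and it DISCHARGES the three cross-coefficient hypotheses `hGd₁/hGd₂/hGd₃` (`‖G_i^{(k+1)} − G_i^{(k)}‖ ≤ δG k i`) by the Lipschitz chain of
`OneStepRemainderLoopLipschitz.norm_remCoeffOf_G₁/₂/₃_sub_le`: `δG k i = 192·(d+1)·L·cU k i` with `cU k i` the bondwise closeness of the level-`(i+1)` FUNDAMENTAL fields of the problems
at levels `k+1` and `k` (NE3-type letter, displayed as `hUd`).  **`composed_full_averaging_rate_of_loops`**: the same `TowerLimitRate` conclusion; the displayed remainder hypotheses are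
now: unitarity of `U`, plaquette letters `p`, the one-step main-table sizes `σ₁`, NE3-type cross letters on the DATA only (`cW`, `cU`, `δR` on `W`/`U`, `θ` on `T_Bal`) and the one real
inequality `hrate` — no hypothesis about the coefficient operators remains; and **`composed_full_averaging_rate_of_loops_logChart`**: for a LOG-CHARTED structure group `G ⊆ U(N)`
(`BlockAveragingFederbushGValued.LogChart`; `U(N)`, `SU(N)`) with `𝔤 ↦ P` under `X ↦ (−i)X` and `d·L²·p ≤ ρ`, the membership hypothesis `Y_x ∈ P` is automatic as well.
HONEST FRAMING (T4-DAG p. 1).  A COMPOSITION of kernel theorems about MODEL objects; `R`, `W`, `U`, `(c, P, e)`, `P₄` are DATA asserted by nobody; node NE3's `LocalRate` is consumed BY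
NAME (`hNE3`, OPEN); nothing of Bałaban's asserted beyond the displayed readings of (124)/(114)/(3.15); NOT an instance of Bałaban's minimiser, of (3.35), or of [B7] (15)'s averages
(DIVERGENCE F6 (ζ)); NOT NE2, NOT [B9] (3.16)/(3.26) as printed; **NE2 (U1a) NOT PROVED**; spine PROVED 0/9 unchanged; NOT continuum YM / infinite volume / mass gap / Clay.  HONEST
DEPENDENCY: continuum YM on T⁴ ⇐ BetaPertH ∧ nine spine estimates (0/9 proved); BetaPertH ⇐ (D1) ∧ (D4) ∧ CAP+tail; G-an2-4 gates asym, D1 and NE2/3/4.  No `sorry`.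
-/

noncomputable section

open scoped BigOperators ComplexConjugate Matrix Matrix.Norms.L2Operator Kronecker
open Finset (range)

namespace Summit.QuantumFields.BalabanUV.T4Continuum.NE2.ComposedRemainderLoopRate

open Literature.MathematicalPhysics.QuantumFieldTheory.Balaban1983to89.B5Prop11Plancherel (Tor fine unitVec Cst)
open Literature.MathematicalPhysics.QuantumFieldTheory.Balaban1983to89.B5G183RateUnitTower (lev lev_neZero)
open Literature.MathematicalPhysics.QuantumFieldTheory.Balaban1983to89.T4EtaRateMin (LocalRate)
open Literature.MathematicalPhysics.QuantumFieldTheory.Balaban1983to89.B9AdOrthogonal (form)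
open Summit.QuantumFields.BalabanUV.T4Continuum
open Summit.QuantumFields.BalabanUV.T4Continuum.BalabanAveragedTowerUnit (idx Qlev)
open Summit.QuantumFields.BalabanUV.T4Continuum.KingPairingPlantedLaw (JpcT calDalev CJ)
open Summit.QuantumFields.BalabanUV.T4Continuum.GramPerturbationLaw (C2gram)
open Summit.QuantumFields.BalabanUV.T4Continuum.CovariantAveragingTower (TowerLimitRate)
open Summit.QuantumFields.BalabanUV.T4Continuum.BackgroundResolventTower (PerturbationLaws Cpert)
open Summit.QuantumFields.BalabanUV.T4Continuum.RegularBackgroundTower (RegularTransporters regClass)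
open Summit.QuantumFields.BalabanUV.T4Continuum.NE2FromNE3 (bgReadings)
open Summit.QuantumFields.BalabanUV.T4Continuum.CovariantAveragingSummand (kappaQ)
open Summit.QuantumFields.BalabanUV.T4Continuum.NE2BalabanLayer (tierBPert kappaB C2B)
open Summit.QuantumFields.BalabanUV.T4Continuum.NE2.CovariantTableBalaban (TBal)
open Summit.QuantumFields.BalabanUV.T4Continuum.NE2.ComposedAveragingMean (thetaZero)
open Summit.QuantumFields.BalabanUV.T4Continuum.NE2.ComposedAveragingRemainder (avgPertFull)
open Summit.QuantumFields.BalabanUV.T4Continuum.NE2.OneStepRemainder (Smain)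
open Summit.QuantumFields.BalabanUV.T4Continuum.NE2.ComposedRemainderTower (RemCoeff Erem cR)
open Summit.QuantumFields.BalabanUV.T4Continuum.NE2.ComposedRemainderTwoLevel (sameBnd crossBnd DeltaStep epsStep composed_full_averaging_rate_of_letters)
open Literature.MathematicalPhysics.QuantumFieldTheory.Balaban1983to89 (LogChart)
open Summit.QuantumFields.BalabanUV.T4Continuum.NE2.OneStepRemainderLoopCoeff (YxT remCoeffOf norm_remCoeffOf_G₁_le norm_remCoeffOf_G₂_le norm_remCoeffOf_G₃_le norm_remCoeffOf_Rc_le YxT_mem_of_logChart)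
open Summit.QuantumFields.BalabanUV.T4Continuum.NE2.OneStepRemainderLoopLipschitz (norm_remCoeffOf_G₁_sub_le norm_remCoeffOf_G₂_sub_le norm_remCoeffOf_G₃_sub_le)

variable {d : ℕ} (L : ℕ) [NeZero L] (M : Fin d → ℕ) [hM : ∀ μ, NeZero (M μ)] (a : ℝ) (ha : 0 < a)
  {n : Type} [Fintype n] [DecidableEq n] [Nonempty n] {ι : Type} [Fintype ι] [DecidableEq ι] [Nonempty ι]
  {c : ℝ} (hc : 0 < c) (P : Submodule ℝ (Matrix n n ℂ)) (hPh : ∀ X ∈ P, X.IsHermitian) (e : ι → Matrix n n ℂ) (he : ∀ k, e k ∈ P)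
  (horth : ∀ k l, form c (e k) (e l) = if k = l then (1 : ℝ) else 0) (hcompl : ∀ X ∈ P, ∑ k, form c (e k) X • e k = X)
  (hPad : ∀ Y ∈ P, ∀ X ∈ P, Complex.I • (Y * X - X * Y) ∈ P)

include hc hPh he horth hcompl hPad in
/-- **THE (3.26)-SHAPE END WITH THE FULL LINEARISED COMPOSED AVERAGING, EVERY COEFFICIENT HYPOTHESIS DISCHARGED**: gen 5's `composed_full_averaging_rate_of_letters` with the remainder
coefficients `Cf k := remCoeffOf L M (U k) c e (W k)` — (124)'s `G₁, G₂, G₃` as the §A functional calculus of the loop logarithms of the fundamental field tower `U k`, `R̄_{0,c}` = the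
adjoint field `W k` at the coarse bond —, `γ k i := 64·d·L²·p k (i+1)` and `δG k i := 192·(d+1)·L·cU k i`; the hypotheses `hG₁/hG₂/hG₃/hRc` (sizes) and `hGd₁/hGd₂/hGd₃` (cross-problem
differences) are PROVED from: unitarity of `U`, plaquette letters `p` with `d·L²·p ≤ 1/16`, the `Y_x` in the frame's carrier `P`, and the closeness letters `cU` of the fundamental fields.
Everything else is displayed verbatim as there.
[cite: Balaban1985BackgroundPropagators, (3.15)–(3.16) p.393, (3.26) p.395; Balaban1985Averaging, (114) p.34, (124)–(126) p.36, (139)–(143) p.39; King1986, Lemma 4.5 (4.38) p.674 (method)] [folklore] -/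
theorem composed_full_averaging_rate_of_loops (hL : 2 ≤ L) (hd : 1 ≤ d) {R : (k : ℕ) → Fin d → (idx L M k → Matrix ι ι ℂ)} {αR βR : ℝ}
    (hreg : RegularTransporters L M R αR βR) {C : ℝ} (hC : 0 ≤ C) (hNE3 : LocalRate (bgReadings L M (regClass L M R)) C ((L : ℝ)⁻¹))
    {W : ℕ → (i : ℕ) → Fin d → (idx L M i → Matrix ι ι ℂ)} {α σ θc ρ : ℝ}
    (hα : 0 ≤ α) (hσ : 0 ≤ σ) (hθ0 : 0 ≤ θc) (hθ1 : θc ≤ 1) (hθρ : θc ≤ ρ) (hρ : 3 / (2 * (L : ℝ)) ≤ ρ) (hρ1 : ρ < 1)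
    (hWn : ∀ k i ν b, ‖W k i ν b‖ ≤ 1) (hWa : ∀ k i ν b, ‖W k i ν b - 1‖ ≤ α / (lev L i : ℕ))
    (hWc : ∀ k i ν b, i ≤ k → ‖W (k + 1) i ν b - W k i ν b‖ ≤ σ * θc ^ k / (lev L i : ℕ))
    {U : ℕ → (i : ℕ) → Fin d → (idx L M i → Matrix n n ℂ)} (hUu : ∀ k i ν b, U k i ν b ∈ Matrix.unitaryGroup n ℂ) {p : ℕ → ℕ → ℝ} (hp0 : ∀ k i, 0 ≤ p k i)
    (hp : ∀ k i (x : Tor (fine (L * lev L i) M)) (ν μ : Fin d),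
      ‖U k (i + 1) ν (x, μ) * U k (i + 1) μ (x + unitVec (fine (L * lev L i) M) ν, μ) - U k (i + 1) μ (x, μ) * U k (i + 1) ν (x + unitVec (fine (L * lev L i) M) μ, μ)‖ ≤ p k (i + 1))
    (hpL : ∀ k i, d * (L : ℝ) ^ 2 * p k (i + 1) ≤ 1 / 16) (hYP : ∀ k i x μ r, YxT L M (U k) i x μ r ∈ P)
    {σ₁ cW cU δR : ℕ → ℕ → ℝ} {θ : ℕ → ℝ} {Γ E Cr : ℝ}
    (hσ₁0 : ∀ k i, 0 ≤ σ₁ k i) (hcW0 : ∀ k i, 0 ≤ cW k i) (hcU0 : ∀ k i, 0 ≤ cU k i) (hδR0 : ∀ k i, 0 ≤ δR k i) (hθ0' : ∀ k, 0 ≤ θ k)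
    (hS : ∀ k i x r μ (s : Fin L), ‖(haveI := lev_neZero L i; Smain (lev L i) L M (W k (i + 1)) x r μ s) - 1‖ ≤ σ₁ k i)
    (hΓ : ∀ k k', ∑ i ∈ range k', (64 * (d * (L : ℝ) ^ 2 * p k (i + 1))) ≤ Γ) (hE : ∀ k k', ∑ i ∈ range k', (Fintype.card ι * σ₁ k i + cR d L ι * (64 * (d * (L : ℝ) ^ 2 * p k (i + 1)))) ≤ E)
    (hWd : ∀ k i ν b, ‖W (k + 1) (i + 1) ν b - W k (i + 1) ν b‖ ≤ cW k i) (hUd : ∀ k i ν b, ‖U (k + 1) (i + 1) ν b - U k (i + 1) ν b‖ ≤ cU k i)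
    (hRd : ∀ k i x μ, ‖W (k + 1) i μ (x, μ) - W k i μ (x, μ)‖ ≤ δR k i)
    (hT : ∀ k y j μ (t : Fin (lev L k)), ‖TBal L M (W (k + 1)) k y j μ t - TBal L M (W k) k y j μ t‖ ≤ θ k)
    (hrate : ∀ k,
      sameBnd d L ι (Cst d a) ((1 + Fintype.card ι * (Real.exp ((((d + 1) * L : ℕ) : ℝ) * α) - 1)) * cR d L ι * Γ * Real.exp E)
          (1 + Fintype.card ι * (Real.exp ((((d + 1) * L : ℕ) : ℝ) * α) - 1) + (1 + Fintype.card ι * (Real.exp ((((d + 1) * L : ℕ) : ℝ) * α) - 1)) * cR d L ι * Γ * Real.exp E)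
          (σ₁ (k + 1) k) (64 * (d * (L : ℝ) ^ 2 * p (k + 1) (k + 1))) (lev L k)
        + crossBnd ι (Cst d a) (1 + Fintype.card ι * (Real.exp ((((d + 1) * L : ℕ) : ℝ) * α) - 1) + (1 + Fintype.card ι * (Real.exp ((((d + 1) * L : ℕ) : ℝ) * α) - 1)) * cR d L ι * Γ * Real.exp E)
          (∑ i ∈ range k, DeltaStep d L ι (cW k i) (64 * (d * (L : ℝ) ^ 2 * p k (i + 1))) (192 * ((d + 1) * L) * cU k i) (δR k i)) (∏ i ∈ range k, (1 + epsStep d L ι (σ₁ (k + 1) i) (64 * (d * (L : ℝ) ^ 2 * p (k + 1) (i + 1))))) (θ k)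
        ≤ Cr * ρ ^ k)
    {P₄ : (k : ℕ) → Matrix (idx L M k × ι) (idx L M k × ι) ℂ} {κ₄ C₄ : ℝ}
    (hP₄ : PerturbationLaws (fun k => calDalev L M a ha k ⊗ₖ (1 : Matrix ι ι ℂ)) P₄ (fun k => JpcT L M k ⊗ₖ (1 : Matrix ι ι ℂ)) κ₄ (fun k => C₄ * ρ ^ k))
    (hsmall : kappaB ι d a αR βR C (kappaQ d a (a : ℂ) (Fintype.card ι * (Real.exp ((((d + 1) * L : ℕ) : ℝ) * α) - 1)
      + (1 + Fintype.card ι * (Real.exp ((((d + 1) * L : ℕ) : ℝ) * α) - 1)) * cR d L ι * Γ * Real.exp E)) κ₄ < 1) :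
    TowerLimitRate (fun k => Qlev L M k ⊗ₖ (1 : Matrix ι ι ℂ)) ((L : ℝ) ^ d)
      (fun k => (calDalev L M a ha k ⊗ₖ (1 : Matrix ι ι ℂ)
        + tierBPert L M R (avgPertFull L M a (fun k => TBal L M (W k) k) (fun k => Erem L M (W k) (remCoeffOf L M (U k) c e (W k)) k)) P₄ k)⁻¹)
      (Cpert (kappaB ι d a αR βR C (kappaQ d a (a : ℂ) (Fintype.card ι * (Real.exp ((((d + 1) * L : ℕ) : ℝ) * α) - 1)
          + (1 + Fintype.card ι * (Real.exp ((((d + 1) * L : ℕ) : ℝ) * α) - 1)) * cR d L ι * Γ * Real.exp E)) κ₄) (2 * d * Cst d a) (CJ d a)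
        (C2B ι d L a αR βR C
          (a * C2gram (Cst d a) 1 (Fintype.card ι * (Real.exp ((((d + 1) * L : ℕ) : ℝ) * α) - 1)
              + (1 + Fintype.card ι * (Real.exp ((((d + 1) * L : ℕ) : ℝ) * α) - 1)) * cR d L ι * Γ * Real.exp E) (2 * d * Cst d a) (CJ d a) (Cst d a)
            (Cst d a * Fintype.card ι * (thetaZero d L α σ + (Real.exp ((((d + 1) * L : ℕ) : ℝ) * α) - 1)) + Cr)) C₄) 0 1) ρ  := by
  have hdL : ∀ k i, 0 ≤ 64 * (d * (L : ℝ) ^ 2 * p k (i + 1)) := fun k i => by have := hp0 k (i + 1); positivity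
  have hdG : ∀ k i, 0 ≤ 192 * ((d + 1) * (L : ℝ)) * cU k i := fun k i => by have := hcU0 k i; positivity
  -- the common plaquette letter of the two problems at a step
  have hpm : ∀ k i (x : Tor (fine (L * lev L i) M)) (ν μ : Fin d),
      ‖U k (i + 1) ν (x, μ) * U k (i + 1) μ (x + unitVec (fine (L * lev L i) M) ν, μ) - U k (i + 1) μ (x, μ) * U k (i + 1) ν (x + unitVec (fine (L * lev L i) M) μ, μ)‖
        ≤ max (p (k + 1) (i + 1)) (p k (i + 1)) := fun k i x ν μ => (hp k i x ν μ).trans (le_max_right _ _)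
  have hpm' : ∀ k i (x : Tor (fine (L * lev L i) M)) (ν μ : Fin d),
      ‖U (k + 1) (i + 1) ν (x, μ) * U (k + 1) (i + 1) μ (x + unitVec (fine (L * lev L i) M) ν, μ)
        - U (k + 1) (i + 1) μ (x, μ) * U (k + 1) (i + 1) ν (x + unitVec (fine (L * lev L i) M) μ, μ)‖ ≤ max (p (k + 1) (i + 1)) (p k (i + 1)) :=
    fun k i x ν μ => (hp (k + 1) i x ν μ).trans (le_max_left _ _)
  have hpm0 : ∀ k i, 0 ≤ max (p (k + 1) (i + 1)) (p k (i + 1)) := fun k i => le_max_of_le_left (hp0 _ _)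
  have hpmL : ∀ k i, d * (L : ℝ) ^ 2 * max (p (k + 1) (i + 1)) (p k (i + 1)) ≤ 1 / 16 := fun k i => by
    rcases le_total (p (k + 1) (i + 1)) (p k (i + 1)) with h | h
    · rw [max_eq_right h]; exact hpL k i
    · rw [max_eq_left h]; exact hpL (k + 1) i
  exact composed_full_averaging_rate_of_letters L M a ha hL hd hreg hC hNE3 hα hσ hθ0 hθ1 hθρ hρ hρ1 hWn hWa hWc
    (Cf := fun k => remCoeffOf L M (U k) c e (W k)) (γ := fun k i => 64 * (d * (L : ℝ) ^ 2 * p k (i + 1))) (δG := fun k i => 192 * ((d + 1) * (L : ℝ)) * cU k i)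
    hσ₁0 hdL hcW0 hdG hδR0 hθ0' hS
    (fun k i x μ r => norm_remCoeffOf_G₁_le L M hc P hPh e he horth hcompl hPad (hUu k) (hp0 k (i + 1)) i (hp k i) (hpL k i) (hYP k i) (W k) x μ r)
    (fun k i x μ r => norm_remCoeffOf_G₂_le L M hc P hPh e he horth hcompl hPad (hUu k) (hp0 k (i + 1)) i (hp k i) (hpL k i) (hYP k i) (W k) x μ r)
    (fun k i x μ => norm_remCoeffOf_G₃_le L M hc P hPh e he horth hcompl hPad (hUu k) (hp0 k (i + 1)) i (hp k i) (hpL k i) (hYP k i) (W k) x μ)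
    (fun k i x μ => norm_remCoeffOf_Rc_le L M (U := U k) (c := c) e (hWn k) i x μ)
    hΓ hE hWd
    (fun k i x μ r => norm_remCoeffOf_G₁_sub_le L M hc P hPh e he horth hcompl hPad (hUu (k + 1)) (hUu k) (hpm0 k i) i (hpm' k i) (hpm k i) (hpmL k i) (hYP (k + 1) i) (hYP k i)
      (hUd k i) (W (k + 1)) (W k) x μ r)
    (fun k i x μ r => norm_remCoeffOf_G₂_sub_le L M hc P hPh e he horth hcompl hPad (hUu (k + 1)) (hUu k) (hpm0 k i) i (hpm' k i) (hpm k i) (hpmL k i) (hYP (k + 1) i) (hYP k i)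
      (hUd k i) (W (k + 1)) (W k) x μ r)
    (fun k i x μ => norm_remCoeffOf_G₃_sub_le L M hc P hPh e he horth hcompl hPad (hUu (k + 1)) (hUu k) (hpm0 k i) i (hpm' k i) (hpm k i) (hpmL k i) (hYP (k + 1) i) (hYP k i)
      (hUd k i) (W (k + 1)) (W k) x μ)
    (fun k i x μ => hRd k i x μ) hT hrate hP₄ hsmall

include hc hPh he horth hcompl hPad in
/-- **THE SAME END FOR A LOG-CHARTED STRUCTURE GROUP** (`U(N)`, `SU(N)`, …: `BlockAveragingFederbushGValued.unitaryLogChart` / `specialUnitaryLogChart`): when the fundamental data are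
`G`-valued, `G` is `⋆`-closed with `G ⊆ U(N)`, its Lie algebra maps into the frame's carrier `P` under `X ↦ (−i)X`, and the plaquette letters stay inside the chart radius (`d·L²·p ≤ ρ`), the
membership hypothesis `hYP` of `composed_full_averaging_rate_of_loops` is automatic (`YxT_mem_of_logChart`). [folklore] -/
theorem composed_full_averaging_rate_of_loops_logChart (hL : 2 ≤ L) (G : LogChart (Matrix n n ℂ))
    (hGu : ∀ ⦃g⦄, g ∈ G.carrier → g ∈ Matrix.unitaryGroup n ℂ) (hGstar : ∀ ⦃g⦄, g ∈ G.carrier → star g ∈ G.carrier) (hPG : ∀ X ∈ G.lie, (-Complex.I) • X ∈ P) (hd : 1 ≤ d) {R : (k : ℕ) → Fin d → (idx L M k → Matrix ι ι ℂ)} {αR βR : ℝ}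
    (hreg : RegularTransporters L M R αR βR) {C : ℝ} (hC : 0 ≤ C) (hNE3 : LocalRate (bgReadings L M (regClass L M R)) C ((L : ℝ)⁻¹))
    {W : ℕ → (i : ℕ) → Fin d → (idx L M i → Matrix ι ι ℂ)} {α σ θc ρ : ℝ}
    (hα : 0 ≤ α) (hσ : 0 ≤ σ) (hθ0 : 0 ≤ θc) (hθ1 : θc ≤ 1) (hθρ : θc ≤ ρ) (hρ : 3 / (2 * (L : ℝ)) ≤ ρ) (hρ1 : ρ < 1)
    (hWn : ∀ k i ν b, ‖W k i ν b‖ ≤ 1) (hWa : ∀ k i ν b, ‖W k i ν b - 1‖ ≤ α / (lev L i : ℕ))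
    (hWc : ∀ k i ν b, i ≤ k → ‖W (k + 1) i ν b - W k i ν b‖ ≤ σ * θc ^ k / (lev L i : ℕ))
    {U : ℕ → (i : ℕ) → Fin d → (idx L M i → Matrix n n ℂ)} (hUG : ∀ k i ν b, U k i ν b ∈ G.carrier) {p : ℕ → ℕ → ℝ} (hp0 : ∀ k i, 0 ≤ p k i)
    (hp : ∀ k i (x : Tor (fine (L * lev L i) M)) (ν μ : Fin d),
      ‖U k (i + 1) ν (x, μ) * U k (i + 1) μ (x + unitVec (fine (L * lev L i) M) ν, μ) - U k (i + 1) μ (x, μ) * U k (i + 1) ν (x + unitVec (fine (L * lev L i) M) μ, μ)‖ ≤ p k (i + 1))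
    (hpL : ∀ k i, d * (L : ℝ) ^ 2 * p k (i + 1) ≤ 1 / 16) (hpG : ∀ k i, d * (L : ℝ) ^ 2 * p k (i + 1) ≤ G.ρ)
    {σ₁ cW cU δR : ℕ → ℕ → ℝ} {θ : ℕ → ℝ} {Γ E Cr : ℝ}
    (hσ₁0 : ∀ k i, 0 ≤ σ₁ k i) (hcW0 : ∀ k i, 0 ≤ cW k i) (hcU0 : ∀ k i, 0 ≤ cU k i) (hδR0 : ∀ k i, 0 ≤ δR k i) (hθ0' : ∀ k, 0 ≤ θ k)
    (hS : ∀ k i x r μ (s : Fin L), ‖(haveI := lev_neZero L i; Smain (lev L i) L M (W k (i + 1)) x r μ s) - 1‖ ≤ σ₁ k i)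
    (hΓ : ∀ k k', ∑ i ∈ range k', (64 * (d * (L : ℝ) ^ 2 * p k (i + 1))) ≤ Γ) (hE : ∀ k k', ∑ i ∈ range k', (Fintype.card ι * σ₁ k i + cR d L ι * (64 * (d * (L : ℝ) ^ 2 * p k (i + 1)))) ≤ E)
    (hWd : ∀ k i ν b, ‖W (k + 1) (i + 1) ν b - W k (i + 1) ν b‖ ≤ cW k i) (hUd : ∀ k i ν b, ‖U (k + 1) (i + 1) ν b - U k (i + 1) ν b‖ ≤ cU k i)
    (hRd : ∀ k i x μ, ‖W (k + 1) i μ (x, μ) - W k i μ (x, μ)‖ ≤ δR k i)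
    (hT : ∀ k y j μ (t : Fin (lev L k)), ‖TBal L M (W (k + 1)) k y j μ t - TBal L M (W k) k y j μ t‖ ≤ θ k)
    (hrate : ∀ k,
      sameBnd d L ι (Cst d a) ((1 + Fintype.card ι * (Real.exp ((((d + 1) * L : ℕ) : ℝ) * α) - 1)) * cR d L ι * Γ * Real.exp E)
          (1 + Fintype.card ι * (Real.exp ((((d + 1) * L : ℕ) : ℝ) * α) - 1) + (1 + Fintype.card ι * (Real.exp ((((d + 1) * L : ℕ) : ℝ) * α) - 1)) * cR d L ι * Γ * Real.exp E)
          (σ₁ (k + 1) k) (64 * (d * (L : ℝ) ^ 2 * p (k + 1) (k + 1))) (lev L k)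
        + crossBnd ι (Cst d a) (1 + Fintype.card ι * (Real.exp ((((d + 1) * L : ℕ) : ℝ) * α) - 1) + (1 + Fintype.card ι * (Real.exp ((((d + 1) * L : ℕ) : ℝ) * α) - 1)) * cR d L ι * Γ * Real.exp E)
          (∑ i ∈ range k, DeltaStep d L ι (cW k i) (64 * (d * (L : ℝ) ^ 2 * p k (i + 1))) (192 * ((d + 1) * L) * cU k i) (δR k i)) (∏ i ∈ range k, (1 + epsStep d L ι (σ₁ (k + 1) i) (64 * (d * (L : ℝ) ^ 2 * p (k + 1) (i + 1))))) (θ k)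
        ≤ Cr * ρ ^ k)
    {P₄ : (k : ℕ) → Matrix (idx L M k × ι) (idx L M k × ι) ℂ} {κ₄ C₄ : ℝ}
    (hP₄ : PerturbationLaws (fun k => calDalev L M a ha k ⊗ₖ (1 : Matrix ι ι ℂ)) P₄ (fun k => JpcT L M k ⊗ₖ (1 : Matrix ι ι ℂ)) κ₄ (fun k => C₄ * ρ ^ k))
    (hsmall : kappaB ι d a αR βR C (kappaQ d a (a : ℂ) (Fintype.card ι * (Real.exp ((((d + 1) * L : ℕ) : ℝ) * α) - 1)
      + (1 + Fintype.card ι * (Real.exp ((((d + 1) * L : ℕ) : ℝ) * α) - 1)) * cR d L ι * Γ * Real.exp E)) κ₄ < 1) :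
    TowerLimitRate (fun k => Qlev L M k ⊗ₖ (1 : Matrix ι ι ℂ)) ((L : ℝ) ^ d)
      (fun k => (calDalev L M a ha k ⊗ₖ (1 : Matrix ι ι ℂ)
        + tierBPert L M R (avgPertFull L M a (fun k => TBal L M (W k) k) (fun k => Erem L M (W k) (remCoeffOf L M (U k) c e (W k)) k)) P₄ k)⁻¹)
      (Cpert (kappaB ι d a αR βR C (kappaQ d a (a : ℂ) (Fintype.card ι * (Real.exp ((((d + 1) * L : ℕ) : ℝ) * α) - 1)
          + (1 + Fintype.card ι * (Real.exp ((((d + 1) * L : ℕ) : ℝ) * α) - 1)) * cR d L ι * Γ * Real.exp E)) κ₄) (2 * d * Cst d a) (CJ d a)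
        (C2B ι d L a αR βR C
          (a * C2gram (Cst d a) 1 (Fintype.card ι * (Real.exp ((((d + 1) * L : ℕ) : ℝ) * α) - 1)
              + (1 + Fintype.card ι * (Real.exp ((((d + 1) * L : ℕ) : ℝ) * α) - 1)) * cR d L ι * Γ * Real.exp E) (2 * d * Cst d a) (CJ d a) (Cst d a)
            (Cst d a * Fintype.card ι * (thetaZero d L α σ + (Real.exp ((((d + 1) * L : ℕ) : ℝ) * α) - 1)) + Cr)) C₄) 0 1) ρ   :=
  composed_full_averaging_rate_of_loops L M a ha hc P hPh e he horth hcompl hPad hL hd hreg hC hNE3 hα hσ hθ0 hθ1 hθρ hρ hρ1 hWn hWa hWc (fun k i ν b => hGu (hUG k i ν b)) hp0 hp hpL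
    (fun k i x μ r => YxT_mem_of_logChart L M G hGu hGstar P hPG (hUG k) (hp0 k (i + 1)) i (hp k i) (hpG k i) x μ r)
    hσ₁0 hcW0 hcU0 hδR0 hθ0' hS hΓ hE hWd hUd hRd hT hrate hP₄ hsmall

end Summit.QuantumFields.BalabanUV.T4Continuum.NE2.ComposedRemainderLoopRate

end
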